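import Summits.AtomisticToContinuum.Crystallization.Theorems.ChartedPlanarOrderDoorLayered
import Literature.Geometry.DiscreteGeometry.LayerShells
import Mathlib.NumberTheory.DiophantineApproximation.Basic

/-!
# «DoorLayered» BRIDGE B (critic rows 407 (2), 409 (2), 411; lens-2 g23 ASK (2)) — the exact branch (β) in the chart currency of record:
# `TwoPeriodic Λ S ∧ IsSep δ S ∧ 0 ∈ S ⟹ S = LayeredHom L w` with `‖L‖, ‖L⁻¹‖ ≤ Λ′(Λ, δ) := 4Λ + 13Λ/δ²`,
# hence `NearHomBD Λ′ τ r S S` for all `τ ≥ 0` and all `r`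

lens-3 g22 (decomp-a2c).  New file (the node `DoorLayered.lean` is frozen); imports the landed part C (hand-2 g8, p819018) and Mathlib's
Dirichlet approximation theorem.  PROVED, no sorry:
* `le_norm_zsmul_add_zsmul` — two independent periods of a `δ`-separated non-empty set generate an in-plane lattice of minimum `≥ δ`;
* `height_gt` — LATTICE GEOMETRY BY DIRICHLET'S APPROXIMATION THEOREM (`Real.exists_int_int_abs_mul_sub_le`, pigeonhole done by Mathlib):
  generators of length `≤ Λ` and minimum `≥ δ` force the height of `b` over the line `ℝa` to exceed `δ²/(6Λ)` (a nonzero lattice vector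
  `k b − j a`, `1 ≤ k ≤ n = ⌈2Λ/δ⌉`, `|k t − j| ≤ 1/(n+1)`, has norm `≤ n·height + Λ/(n+1)` and `≥ δ`) — this replaces the Hermite /
  Gauss-reduction covolume bound announced in the node header (weaker constant, polynomial in `Λ/δ`, fully elementary);
* `exists_chart` — an explicit continuous linear automorphism `L` with `L t₁ = a`, `L t₂ = b`, `L e₃ ⊥ a, b`, `‖L‖ ≤ 4Λ ≤ Λ′`,
  `‖L⁻¹‖ ≤ 12Λ/δ² + 1/Λ ≤ Λ′` (inverse written with the dual vectors `a − s₀b ⊥ b`, `b − t₀a ⊥ a`, and the cross product);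
* ★ `layeredHom_of_twoPeriodic` (bridge B, model form, the shape lens-2 g23 asked for), `nearHomBD_of_twoPeriodic` (chart form, `Ψ = id`,
  every tolerance `τ ≥ 0`, every radius), and the door-level reading `nearHomBD_of_doorPeriodic : DoorPeriodic Λ → … → NearHomBD Λ′ τ r S S`.
HONEST LIMIT: `Λ′` depends on the separation `δ` (as it must: a two-periodic set with a very short period has a very distorted chart), so the
bridge lands in `DoorHomogeneityBD`'s currency door set by door set, with `Λ′(Λ, δ)`, not as `DoorPeriodic Λ → DoorHomogeneityBD Λ″` with one
`Λ″`; lens-2's A♭ `ExactLayeredBulkGap` quantifies `δ` and consumes exactly `layeredHom_of_twoPeriodic`.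
-/

noncomputable section

open MeasureTheory Set Metric
open scoped RealInnerProductSpace
open Summit.AtomisticToContinuum.Crystallization.Theorems.ChartedPlanarOrderRigidityDoor
open Summit.AtomisticToContinuum.Crystallization.Theorems.ChartedPlanarOrderDensityDichotomy
open Summit.AtomisticToContinuum.Crystallization.Theorems.ChartedPlanarOrderMesoCut
open Summit.AtomisticToContinuum.Crystallization.Theorems.OverbindingBudgetLiouvilleDictionary
open Summit.AtomisticToContinuum.Crystallization.Theorems.ChartedPlanarOrderDoorLayered

open Literature.MathematicalPhysics.StatisticalMechanics (triangularVec₁ triangularVec₂ layerNormal)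
open Literature.Geometry.DiscreteGeometry (inner_fin3)

namespace Summit.AtomisticToContinuum.Crystallization.Theorems.ChartedPlanarOrderDoorLayeredBridge

/-! ## 1. Coordinates, the cross product, unit vectors -/

/-- the cross product on `E3` (coordinates). [folklore] -/
def cross (a b : E3) : E3 := !₂[a 1 * b 2 - a 2 * b 1, a 2 * b 0 - a 0 * b 2, a 0 * b 1 - a 1 * b 0]

/-- `a × b ⊥ a`. [folklore] -/
theorem inner_cross_fst (a b : E3) : ⟪cross a b, a⟫ = 0 := by
  rw [inner_fin3]; simp [cross]; ring

/-- `a × b ⊥ b`. [folklore] -/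
theorem inner_cross_snd (a b : E3) : ⟪cross a b, b⟫ = 0 := by
  rw [inner_fin3]; simp [cross]; ring

/-- Lagrange's identity `‖a × b‖² = ‖a‖²‖b‖² − ⟨a, b⟩²`. [folklore] -/
theorem norm_cross_sq (a b : E3) : ‖cross a b‖ ^ 2 = ‖a‖ ^ 2 * ‖b‖ ^ 2 - ⟪a, b⟫ ^ 2 := by
  rw [EuclideanSpace.norm_sq_eq, EuclideanSpace.norm_sq_eq, EuclideanSpace.norm_sq_eq, inner_fin3]
  simp [Fin.sum_univ_three, cross, Real.norm_eq_abs, sq_abs]; ring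

/-- `‖e₃‖ = 1`. [folklore] -/
theorem norm_layerNormal_one : ‖layerNormal 1‖ = 1 := by
  rw [EuclideanSpace.norm_eq, Fin.sum_univ_three, Real.sqrt_eq_one]
  simp [layerNormal]

/-- coordinates in the basis `(t₁, t₂, e₃)`. [folklore] -/
theorem coord_decomp (x : E3) :
    (x 0 - x 1 / Real.sqrt 3) • triangularVec₁ 1 + (2 * x 1 / Real.sqrt 3) • triangularVec₂ 1 + x 2 • layerNormal 1 = x := by
  have h3 : Real.sqrt 3 ≠ 0 := by positivity
  ext i; fin_cases i <;> simp [triangularVec₁, triangularVec₂, layerNormal]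
  all_goals field_simp
  all_goals ring

/-! ## 2. Lattice minimum from separation; height from Dirichlet -/

/-- two independent periods of a `δ`-separated non-empty set generate a lattice of minimum `≥ δ`. -/
theorem le_norm_zsmul_add_zsmul {δ : ℝ} {S : Set E3} (hS : IsSep δ S) (hne : S.Nonempty) {a b : E3}
    (hab : LinearIndependent ℝ ![a, b]) (ha : IsPeriod S a) (hb : IsPeriod S b) (i j : ℤ) (hij : i ≠ 0 ∨ j ≠ 0) :
    δ ≤ ‖(i : ℝ) • a + (j : ℝ) • b‖ := by
  obtain ⟨x, hx⟩ := hne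
  have h1 : x + (j : ℝ) • b ∈ S := (hb.zsmul_mem j x).2 hx
  have h2 : x + (j : ℝ) • b + (i : ℝ) • a ∈ S := (ha.zsmul_mem i _).2 h1
  have e : x + (j : ℝ) • b + (i : ℝ) • a - x = (i : ℝ) • a + (j : ℝ) • b := by abel
  have hne' : x + (j : ℝ) • b + (i : ℝ) • a ≠ x := by
    intro h
    have h0 : (i : ℝ) • a + (j : ℝ) • b = 0 := by rw [← e, h, sub_self]
    have := (LinearIndependent.pair_iff.1 hab) (i : ℝ) (j : ℝ) h0
    rcases hij with hi | hj
    · exact hi (by exact_mod_cast this.1)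
    · exact hj (by exact_mod_cast this.2)
  have := hS _ h2 _ hx hne'
  rwa [dist_eq_norm, e] at this

/-- **height by Dirichlet**: generators of length `≤ Λ`, lattice minimum `≥ δ` ⇒ `dist (b, ℝa) > δ²/(6Λ)`. -/
theorem height_gt {δ Λ : ℝ} (hδ : 0 < δ) {a b : E3} (ha : ‖a‖ ≤ Λ) (hδa : δ ≤ ‖a‖)
    (hmin : ∀ i j : ℤ, (i ≠ 0 ∨ j ≠ 0) → δ ≤ ‖(i : ℝ) • a + (j : ℝ) • b‖) (t : ℝ) :
    δ ^ 2 / (6 * Λ) < ‖b - t • a‖ := by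
  have hΛ : 0 < Λ := by linarith
  obtain ⟨n, hn⟩ : ∃ n : ℕ, n = ⌈2 * Λ / δ⌉₊ := ⟨_, rfl⟩
  have hn0 : 0 < n := by rw [hn]; exact Nat.ceil_pos.2 (by positivity)
  have hnge : 2 * Λ / δ ≤ n := by rw [hn]; exact Nat.le_ceil _
  have hnlt : (n : ℝ) < 2 * Λ / δ + 1 := by rw [hn]; exact Nat.ceil_lt_add_one (by positivity)
  obtain ⟨j, k, hk0, hkn, hjk⟩ := Real.exists_int_int_abs_mul_sub_le t hn0
  have hv := hmin (-j) k (Or.inr (by exact_mod_cast hk0.ne'))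
  have hdec : ((-j : ℤ) : ℝ) • a + (k : ℝ) • b = (k : ℝ) • (b - t • a) + ((k : ℝ) * t - j) • a := by
    push_cast
    rw [smul_sub, sub_smul, smul_smul, neg_smul]; abel
  rw [hdec] at hv
  have hk0' : (0 : ℝ) < k := by exact_mod_cast hk0
  have hkn' : (k : ℝ) ≤ n := by exact_mod_cast hkn
  have h1 : ‖(k : ℝ) • (b - t • a) + ((k : ℝ) * t - j) • a‖ ≤ n * ‖b - t • a‖ + 1 / (n + 1) * Λ := by
    refine (norm_add_le _ _).trans (add_le_add ?_ ?_)
    · rw [norm_smul, Real.norm_eq_abs, abs_of_pos hk0']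
      exact mul_le_mul_of_nonneg_right hkn' (norm_nonneg _)
    · rw [norm_smul, Real.norm_eq_abs]
      exact mul_le_mul hjk ha (norm_nonneg _) (by positivity)
  have h2 : 2 * Λ ≤ n * δ := (div_le_iff₀ hδ).1 hnge
  have h3 : 1 / ((n : ℝ) + 1) * Λ < δ / 2 := by
    rw [div_mul_eq_mul_div, one_mul, div_lt_iff₀ (by positivity)]
    nlinarith
  have h4 : δ / 2 < n * ‖b - t • a‖ := by linarith
  have h5 : (n : ℝ) * δ < 3 * Λ := by
    have h6 : (n : ℝ) * δ < (2 * Λ / δ + 1) * δ := mul_lt_mul_of_pos_right hnlt hδ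
    rw [add_mul, div_mul_cancel₀ _ hδ.ne', one_mul] at h6
    linarith
  have hh : 0 < ‖b - t • a‖ := by
    by_contra hle
    have : ‖b - t • a‖ = 0 := le_antisymm (not_lt.1 hle) (norm_nonneg _)
    rw [this, mul_zero] at h4
    linarith
  have p1 : (n : ℝ) * δ * ‖b - t • a‖ < 3 * Λ * ‖b - t • a‖ := mul_lt_mul_of_pos_right h5 hh
  have p2 : δ / 2 * δ < (n : ℝ) * ‖b - t • a‖ * δ := mul_lt_mul_of_pos_right h4 hδ
  rw [div_lt_iff₀ (by positivity)]
  nlinarith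

/-! ## 3. The explicit bounded-distortion chart -/

/-- **the chart**: generators `a, b` of length `≤ Λ` with lattice minimum `≥ δ` are the images of `t₁, t₂` under a continuous linear
automorphism of distortion `≤ 4Λ + 13Λ/δ²`. -/
theorem exists_chart {δ Λ : ℝ} (hδ : 0 < δ) {a b : E3} (ha : ‖a‖ ≤ Λ) (hb : ‖b‖ ≤ Λ)
    (hmin : ∀ i j : ℤ, (i ≠ 0 ∨ j ≠ 0) → δ ≤ ‖(i : ℝ) • a + (j : ℝ) • b‖) :
    ∃ L : E3 ≃L[ℝ] E3, L (triangularVec₁ 1) = a ∧ L (triangularVec₂ 1) = b ∧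
      ‖(L : E3 →L[ℝ] E3)‖ ≤ 4 * Λ + 13 * Λ / δ ^ 2 ∧ ‖(L.symm : E3 →L[ℝ] E3)‖ ≤ 4 * Λ + 13 * Λ / δ ^ 2 := by
  -- lengths
  have hδa : δ ≤ ‖a‖ := by simpa using hmin 1 0 (by simp)
  have hδb : δ ≤ ‖b‖ := by simpa using hmin 0 1 (by simp)
  have hΛ : 0 < Λ := by linarith
  have hδΛ : δ ≤ Λ := hδa.trans ha
  have ha0 : 0 < ‖a‖ := hδ.trans_le hδa
  have hb0 : 0 < ‖b‖ := hδ.trans_le hδb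
  have hmin' : ∀ i j : ℤ, (i ≠ 0 ∨ j ≠ 0) → δ ≤ ‖(i : ℝ) • b + (j : ℝ) • a‖ := fun i j h => by
    rw [add_comm]; exact hmin j i h.symm
  -- the dual in-plane vectors
  obtain ⟨t₀, ht₀⟩ : ∃ t₀ : ℝ, t₀ = ⟪a, b⟫ / ‖a‖ ^ 2 := ⟨_, rfl⟩
  obtain ⟨s₀, hs₀⟩ : ∃ s₀ : ℝ, s₀ = ⟪a, b⟫ / ‖b‖ ^ 2 := ⟨_, rfl⟩
  obtain ⟨b', hb'⟩ : ∃ b' : E3, b' = b - t₀ • a := ⟨_, rfl⟩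
  obtain ⟨a', ha'⟩ : ∃ a' : E3, a' = a - s₀ • b := ⟨_, rfl⟩
  have hb'pos : δ ^ 2 / (6 * Λ) < ‖b'‖ := by rw [hb']; exact height_gt hδ ha hδa hmin t₀
  have ha'pos : δ ^ 2 / (6 * Λ) < ‖a'‖ := by rw [ha']; exact height_gt hδ hb hδb hmin' s₀
  have hq : 0 < δ ^ 2 / (6 * Λ) := by positivity
  have hb'0 : 0 < ‖b'‖ := hq.trans hb'pos
  have ha'0 : 0 < ‖a'‖ := hq.trans ha'pos
  have iba : ⟪b', a⟫ = 0 := by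
    rw [hb', inner_sub_left, real_inner_smul_left, real_inner_self_eq_norm_sq, ht₀, real_inner_comm, div_mul_cancel₀ _ (by positivity)]
    ring
  have iab : ⟪a', b⟫ = 0 := by
    rw [ha', inner_sub_left, real_inner_smul_left, real_inner_self_eq_norm_sq, hs₀, div_mul_cancel₀ _ (by positivity)]
    ring
  have ibb : ⟪b', b⟫ = ‖b'‖ ^ 2 := by
    have e : b = b' + t₀ • a := by rw [hb']; abel
    conv_lhs => rw [e]
    rw [inner_add_right, real_inner_smul_right, iba, mul_zero, add_zero, real_inner_self_eq_norm_sq]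
  have iaa : ⟪a', a⟫ = ‖a'‖ ^ 2 := by
    have e : a = a' + s₀ • b := by rw [ha']; abel
    conv_lhs => rw [e]
    rw [inner_add_right, real_inner_smul_right, iab, mul_zero, add_zero, real_inner_self_eq_norm_sq]
  -- the normal vector
  have hnb' : ‖b'‖ ^ 2 = ‖b‖ ^ 2 - ⟪a, b⟫ ^ 2 / ‖a‖ ^ 2 := by
    rw [hb', norm_sub_sq_real, real_inner_smul_right, norm_smul, mul_pow, Real.norm_eq_abs, sq_abs, ht₀, real_inner_comm]
    field_simp
    ring
  have hc0 : 0 < ‖cross a b‖ := by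
    have h1 : ‖cross a b‖ ^ 2 = ‖a‖ ^ 2 * ‖b'‖ ^ 2 := by
      rw [norm_cross_sq, hnb']; field_simp
    have h2 : 0 < ‖cross a b‖ ^ 2 := by rw [h1]; positivity
    exact lt_of_pow_lt_pow_left₀ 2 (norm_nonneg _) (by simpa using h2)
  obtain ⟨c, hc⟩ : ∃ c : E3, c = (Λ / ‖cross a b‖) • cross a b := ⟨_, rfl⟩
  have hnc : ‖c‖ = Λ := by
    rw [hc, norm_smul, Real.norm_eq_abs, abs_of_pos (by positivity), div_mul_cancel₀ _ hc0.ne']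
  have ica : ⟪c, a⟫ = 0 := by rw [hc, real_inner_smul_left, inner_cross_fst, mul_zero]
  have icb : ⟪c, b⟫ = 0 := by rw [hc, real_inner_smul_left, inner_cross_snd, mul_zero]
  have icc : ⟪c, c⟫ = Λ ^ 2 := by rw [real_inner_self_eq_norm_sq, hnc]
  have iac : ⟪a', c⟫ = 0 := by
    rw [ha', inner_sub_left, real_inner_smul_left, real_inner_comm c a, real_inner_comm c b, ica, icb]; ring
  have ibc : ⟪b', c⟫ = 0 := by
    rw [hb', inner_sub_left, real_inner_smul_left, real_inner_comm c a, real_inner_comm c b, ica, icb]; ring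
  -- the forward map
  obtain ⟨F, hF⟩ : ∃ F : E3 →L[ℝ] E3, ∀ x : E3,
      F x = (x 0 - x 1 / Real.sqrt 3) • a + (2 * x 1 / Real.sqrt 3) • b + x 2 • c := by
    refine ⟨(EuclideanSpace.proj (𝕜 := ℝ) (0 : Fin 3) - (1 / Real.sqrt 3) • EuclideanSpace.proj (𝕜 := ℝ) (1 : Fin 3)).smulRight a +
      ((2 / Real.sqrt 3) • EuclideanSpace.proj (𝕜 := ℝ) (1 : Fin 3)).smulRight b +
      (EuclideanSpace.proj (𝕜 := ℝ) (2 : Fin 3)).smulRight c, fun x => ?_⟩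
    simp [ContinuousLinearMap.smulRight_apply]
    match_scalars <;> ring
  -- the inverse map
  obtain ⟨G, hG⟩ : ∃ G : E3 →L[ℝ] E3, ∀ y : E3,
      G y = (⟪a', y⟫ / ‖a'‖ ^ 2) • triangularVec₁ 1 + (⟪b', y⟫ / ‖b'‖ ^ 2) • triangularVec₂ 1 +
        (⟪c, y⟫ / Λ ^ 2) • layerNormal 1 := by
    refine ⟨((1 / ‖a'‖ ^ 2) • innerSL ℝ a').smulRight (triangularVec₁ 1) + ((1 / ‖b'‖ ^ 2) • innerSL ℝ b').smulRight (triangularVec₂ 1) +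
      ((1 / Λ ^ 2) • innerSL ℝ c).smulRight (layerNormal 1), fun y => ?_⟩
    simp [ContinuousLinearMap.smulRight_apply]
    match_scalars <;> ring
  -- G ∘ F = id
  have h3 : Real.sqrt 3 ≠ 0 := by positivity
  have h₁ : Function.LeftInverse G F := by
    intro x
    rw [hG, hF]
    have e1 : ⟪a', (x 0 - x 1 / Real.sqrt 3) • a + (2 * x 1 / Real.sqrt 3) • b + x 2 • c⟫ / ‖a'‖ ^ 2 = x 0 - x 1 / Real.sqrt 3 := by
      rw [inner_add_right, inner_add_right, real_inner_smul_right, real_inner_smul_right, real_inner_smul_right, iaa, iab, iac]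
      field_simp
      ring
    have e2 : ⟪b', (x 0 - x 1 / Real.sqrt 3) • a + (2 * x 1 / Real.sqrt 3) • b + x 2 • c⟫ / ‖b'‖ ^ 2 = 2 * x 1 / Real.sqrt 3 := by
      rw [inner_add_right, inner_add_right, real_inner_smul_right, real_inner_smul_right, real_inner_smul_right, iba, ibb, ibc]
      field_simp
      ring
    have e3 : ⟪c, (x 0 - x 1 / Real.sqrt 3) • a + (2 * x 1 / Real.sqrt 3) • b + x 2 • c⟫ / Λ ^ 2 = x 2 := by
      rw [inner_add_right, inner_add_right, real_inner_smul_right, real_inner_smul_right, real_inner_smul_right, ica, icb, icc]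
      field_simp
      ring
    rw [e1, e2, e3]
    exact coord_decomp x
  -- F ∘ G = id, by dimension count
  have hsurj : Function.Surjective F := by
    have hinj : Function.Injective (F : E3 →ₗ[ℝ] E3) := h₁.injective
    exact LinearMap.injective_iff_surjective.1 hinj
  have h₂ : Function.RightInverse G F := fun y => by
    obtain ⟨x, rfl⟩ := hsurj y
    rw [h₁ x]
  obtain ⟨L, hL⟩ : ∃ L : E3 ≃L[ℝ] E3, L = ContinuousLinearEquiv.equivOfInverse F G h₁ h₂ := ⟨_, rfl⟩
  have hLF : ∀ x, L x = F x := fun x => by rw [hL, ContinuousLinearEquiv.equivOfInverse_apply]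
  have hLG : ∀ y, L.symm y = G y := fun y => by
    rw [hL, ContinuousLinearEquiv.symm_equivOfInverse, ContinuousLinearEquiv.equivOfInverse_apply]
  refine ⟨L, ?_, ?_, ?_, ?_⟩
  · rw [hLF, hF]; simp [triangularVec₁]
  · rw [hLF, hF]
    simp only [triangularVec₂]
    simp
    match_scalars
    all_goals field_simp
    all_goals ring
  · -- ‖L‖ ≤ 4Λ
    refine ContinuousLinearMap.opNorm_le_bound _ (by positivity) (fun x => ?_)
    rw [ContinuousLinearEquiv.coe_coe, hLF, hF]
    have hx0 : |x 0| ≤ ‖x‖ := by have h := PiLp.norm_apply_le x 0; rwa [Real.norm_eq_abs] at h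
    have hx1 : |x 1| ≤ ‖x‖ := by have h := PiLp.norm_apply_le x 1; rwa [Real.norm_eq_abs] at h
    have hx2 : |x 2| ≤ ‖x‖ := by have h := PiLp.norm_apply_le x 2; rwa [Real.norm_eq_abs] at h
    have hs3 : (3 : ℝ) / 2 ≤ Real.sqrt 3 := by
      rw [show (3 : ℝ) / 2 = Real.sqrt ((3 / 2) ^ 2) by rw [Real.sqrt_sq (by norm_num)]]
      exact Real.sqrt_le_sqrt (by norm_num)
    have hs0 : 0 < Real.sqrt 3 := by positivity
    have hc1 : |x 0 - x 1 / Real.sqrt 3| ≤ |x 0| + |x 1| / Real.sqrt 3 := by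
      refine (abs_sub _ _).trans ?_
      rw [abs_div, abs_of_pos hs0]
    have hc2 : |2 * x 1 / Real.sqrt 3| = 2 * |x 1| / Real.sqrt 3 := by
      rw [abs_div, abs_mul, abs_of_pos hs0, abs_two]
    have hsum : |x 1| / Real.sqrt 3 + 2 * |x 1| / Real.sqrt 3 ≤ 2 * |x 1| := by
      rw [← add_div, div_le_iff₀ hs0]
      nlinarith [abs_nonneg (x 1)]
    calc ‖(x 0 - x 1 / Real.sqrt 3) • a + (2 * x 1 / Real.sqrt 3) • b + x 2 • c‖
        ≤ ‖(x 0 - x 1 / Real.sqrt 3) • a‖ + ‖(2 * x 1 / Real.sqrt 3) • b‖ + ‖x 2 • c‖ := norm_add₃_le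
      _ = |x 0 - x 1 / Real.sqrt 3| * ‖a‖ + |2 * x 1 / Real.sqrt 3| * ‖b‖ + |x 2| * ‖c‖ := by
          simp only [norm_smul, Real.norm_eq_abs]
      _ ≤ (|x 0| + |x 1| / Real.sqrt 3) * Λ + (2 * |x 1| / Real.sqrt 3) * Λ + |x 2| * Λ := by
          rw [hc2, hnc]
          gcongr
      _ = (|x 0| + (|x 1| / Real.sqrt 3 + 2 * |x 1| / Real.sqrt 3) + |x 2|) * Λ := by ring
      _ ≤ (‖x‖ + 2 * ‖x‖ + ‖x‖) * Λ := by gcongr; exact hsum.trans (by linarith)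
      _ = 4 * Λ * ‖x‖ := by ring
      _ ≤ (4 * Λ + 13 * Λ / δ ^ 2) * ‖x‖ := by gcongr; linarith [show 0 ≤ 13 * Λ / δ ^ 2 by positivity]
  · -- ‖L⁻¹‖ ≤ 12Λ/δ² + 1/Λ
    refine ContinuousLinearMap.opNorm_le_bound _ (by positivity) (fun y => ?_)
    rw [ContinuousLinearEquiv.coe_coe, hLG, hG]
    have i1 := abs_real_inner_le_norm a' y
    have i2 := abs_real_inner_le_norm b' y
    have i3 := abs_real_inner_le_norm c y
    have q1 : |⟪a', y⟫ / ‖a'‖ ^ 2| ≤ ‖y‖ / ‖a'‖ := by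
      rw [abs_div, abs_of_pos (pow_pos ha'0 2), div_le_div_iff₀ (pow_pos ha'0 2) ha'0]
      calc |⟪a', y⟫| * ‖a'‖ ≤ ‖a'‖ * ‖y‖ * ‖a'‖ := mul_le_mul_of_nonneg_right i1 ha'0.le
        _ = ‖y‖ * ‖a'‖ ^ 2 := by ring
    have q2 : |⟪b', y⟫ / ‖b'‖ ^ 2| ≤ ‖y‖ / ‖b'‖ := by
      rw [abs_div, abs_of_pos (pow_pos hb'0 2), div_le_div_iff₀ (pow_pos hb'0 2) hb'0]
      calc |⟪b', y⟫| * ‖b'‖ ≤ ‖b'‖ * ‖y‖ * ‖b'‖ := mul_le_mul_of_nonneg_right i2 hb'0.le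
        _ = ‖y‖ * ‖b'‖ ^ 2 := by ring
    have q3 : |⟪c, y⟫ / Λ ^ 2| ≤ ‖y‖ / Λ := by
      rw [abs_div, abs_of_pos (pow_pos hΛ 2), div_le_div_iff₀ (pow_pos hΛ 2) hΛ]
      rw [hnc] at i3
      calc |⟪c, y⟫| * Λ ≤ Λ * ‖y‖ * Λ := mul_le_mul_of_nonneg_right i3 hΛ.le
        _ = ‖y‖ * Λ ^ 2 := by ring
    have r1 : ‖y‖ / ‖a'‖ ≤ ‖y‖ * (6 * Λ / δ ^ 2) := by
      rw [div_eq_mul_one_div]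
      refine mul_le_mul_of_nonneg_left ?_ (norm_nonneg _)
      rw [one_div_le ha'0 (by positivity), one_div_div]
      exact ha'pos.le
    have r2 : ‖y‖ / ‖b'‖ ≤ ‖y‖ * (6 * Λ / δ ^ 2) := by
      rw [div_eq_mul_one_div]
      refine mul_le_mul_of_nonneg_left ?_ (norm_nonneg _)
      rw [one_div_le hb'0 (by positivity), one_div_div]
      exact hb'pos.le
    have r3 : ‖y‖ / Λ ≤ ‖y‖ * (Λ / δ ^ 2) := by
      rw [div_eq_mul_one_div]
      refine mul_le_mul_of_nonneg_left ?_ (norm_nonneg _)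
      rw [div_le_div_iff₀ hΛ (by positivity), one_mul, ← pow_two]
      exact pow_le_pow_left₀ hδ.le hδΛ 2
    calc ‖(⟪a', y⟫ / ‖a'‖ ^ 2) • triangularVec₁ 1 + (⟪b', y⟫ / ‖b'‖ ^ 2) • triangularVec₂ 1 +
          (⟪c, y⟫ / Λ ^ 2) • layerNormal 1‖
        ≤ ‖(⟪a', y⟫ / ‖a'‖ ^ 2) • triangularVec₁ 1‖ + ‖(⟪b', y⟫ / ‖b'‖ ^ 2) • triangularVec₂ 1‖ +
          ‖(⟪c, y⟫ / Λ ^ 2) • layerNormal 1‖ := norm_add₃_le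
      _ = |⟪a', y⟫ / ‖a'‖ ^ 2| + |⟪b', y⟫ / ‖b'‖ ^ 2| + |⟪c, y⟫ / Λ ^ 2| := by
          simp only [norm_smul, Real.norm_eq_abs, norm_triangularVec₁_one, norm_triangularVec₂_one, norm_layerNormal_one, mul_one]
      _ ≤ ‖y‖ * (6 * Λ / δ ^ 2) + ‖y‖ * (6 * Λ / δ ^ 2) + ‖y‖ * (Λ / δ ^ 2) := by
          gcongr
          · exact q1.trans r1
          · exact q2.trans r2
          · exact q3.trans r3
      _ = (13 * Λ / δ ^ 2) * ‖y‖ := by ring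
      _ ≤ (4 * Λ + 13 * Λ / δ ^ 2) * ‖y‖ := by gcongr; linarith

/-! ## 4. Bridge B -/

/-- ★ **bridge B (model form, the shape lens-2 g23 asked for):** a two-periodic `δ`-separated configuration containing `0` IS a homogeneously
deformed layered structure `LayeredHom L w` over a chart of distortion `≤ 4Λ + 13Λ/δ²`. -/
theorem layeredHom_of_twoPeriodic {Λ δ : ℝ} (hδ : 0 < δ) {S : Set E3} (h0 : (0 : E3) ∈ S) (hS : IsSep δ S) (h : TwoPeriodic Λ S) :
    ∃ (L : E3 ≃L[ℝ] E3) (w : ℤ → E3), ‖(L : E3 →L[ℝ] E3)‖ ≤ 4 * Λ + 13 * Λ / δ ^ 2 ∧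
      ‖(L.symm : E3 →L[ℝ] E3)‖ ≤ 4 * Λ + 13 * Λ / δ ^ 2 ∧ S = LayeredHom (L : E3 →L[ℝ] E3) w := by
  obtain ⟨a, b, hab, ha, hb, w, hSw⟩ := (isLayered_iff_twoPeriodic_of_isSep hδ h0 hS).2 h
  have hpa : IsPeriod S a := by rw [hSw]; exact isPeriod_layered_fst a b w
  have hpb : IsPeriod S b := by rw [hSw]; exact isPeriod_layered_snd a b w
  have hmin := le_norm_zsmul_add_zsmul hS ⟨0, h0⟩ hab hpa hpb
  obtain ⟨L, hL1, hL2, hN, hNs⟩ := exists_chart hδ ha hb hmin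
  refine ⟨L, w, hN, hNs, ?_⟩
  rw [layeredHom_eq_layered, ContinuousLinearEquiv.coe_coe, hL1, hL2]
  exact hSw

/-- **bridge B (chart form):** … hence `NearHomBD Λ′ τ r S S` at every tolerance `τ ≥ 0` and every radius, with `Ψ = id`. -/
theorem nearHomBD_of_twoPeriodic {Λ δ : ℝ} (hδ : 0 < δ) {S : Set E3} (h0 : (0 : E3) ∈ S) (hS : IsSep δ S) (h : TwoPeriodic Λ S)
    {τ : ℝ} (hτ : 0 ≤ τ) (r : ℝ) : NearHomBD (4 * Λ + 13 * Λ / δ ^ 2) τ r S S := by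
  obtain ⟨L, w, hN, hNs, hSw⟩ := layeredHom_of_twoPeriodic hδ h0 hS h
  refine ⟨L, hN, hNs, w, id, Set.injOn_id S, fun x hx => by rw [← hSw]; exact hx, fun x hx => ⟨?_, ?_⟩⟩
  · intro p hp _
    exact ⟨p, by rw [← hSw]; exact hp, by rw [id, dist_self]; exact hτ⟩
  · intro q hq _
    exact ⟨q, by rw [hSw]; exact hq, by rw [id, dist_self]; exact hτ⟩

/-- **bridge B at door level:** under L1′♮ `DoorPeriodic Λ`, every `δ`-door configuration satisfies L1′_BD's clause with distortion
`4Λ + 13Λ/δ²` (the `δ`-dependence is genuine; see the header). -/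
theorem nearHomBD_of_doorPeriodic {Λ : ℝ} (h : DoorPeriodic Λ) {δ : ℝ} (hδ : 0 < δ) {τ : ℝ} (hτ : 0 ≤ τ) (r : ℝ)
    {S : Set E3} (hS : IsDoorSet δ S) : NearHomBD (4 * Λ + 13 * Λ / δ ^ 2) τ r S S :=
  nearHomBD_of_twoPeriodic hδ hS.1 hS.2.1 (h δ hδ S hS) hτ r

end Summit.AtomisticToContinuum.Crystallization.Theorems.ChartedPlanarOrderDoorLayeredBridge
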